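import Summits.BirchSwinnertonDyer.BirchSwinnertonDyer.Theorems.SignedBaseChangeAnticyclotomicEisensteinDivisibilityAdmdefRootDichotomy
import Summits.BirchSwinnertonDyer.BirchSwinnertonDyer.Theorems.SignedBaseChangeAnticyclotomicEisensteinDivisibilityAdmdefRootZero
import Summits.BirchSwinnertonDyer.BirchSwinnertonDyer.Theorems.SignedBaseChangeAnticyclotomicEisensteinDivisibilityAdmdefHeegnerPrimitive
import Summits.BirchSwinnertonDyer.BirchSwinnertonDyer.Theorems.SignedBaseChangeAnticyclotomicEisensteinDivisibilityAdmdefOddSelmerDim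
import Summits.BirchSwinnertonDyer.BirchSwinnertonDyer.Theorems.SignedBaseChangeAnticyclotomicEisensteinDivisibilityAdmdefBipartiteNVLevelOne
import Summits.BirchSwinnertonDyer.BirchSwinnertonDyer.Theorems.SignedBaseChangeAnticyclotomicEisensteinDivisibilityOfStubsAdmdefV14
import Summits.BirchSwinnertonDyer.Rank1Residual.Partition.IrreducibleOverQuadraticField
import Literature.NumberTheory.EllipticCurves.CastellaHsuKunduLeeLiu2025.SignedBipartiteSystemTransferClassDictionary
import Literature.NumberTheory.EllipticCurves.DefiniteBrandtMultiplicityOneModP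
import Literature.NumberTheory.EllipticCurves.BurungaleCastellaSkinner2025.BDPMainConjecture
import Literature.NumberTheory.EllipticCurves.NonEisensteinPrimeOfSurjective
import Literature.NumberTheory.EllipticCurves.PAdicGrossZagierConstantTermProofs
import HarnessLib

/-!
# Line `admdef` v22 on the crux `AnticyclotomicEisensteinDivisibility` (stmt-BirchSwinnertonDyer-20727): [NV]♯ at a point from the cited facts
# (16) bridge-with-Heegner-pinning, (15) multiplicity one, (12)–(13) parity, (7) `μ(L_p^BDP) = 0`, the research text (RV₁)H-pinned (Kolyvagin's
# conjecture mod `p` at the bottom, corank one, for a p-PRIMITIVE signed Heegner class) and (Anch∃)_NP,≥3 — the v22 root dichotomy with the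
# discriminant binders threaded (LEAD bsd-line-sbc-p1 gen 24; Theorems-level twin of `Lines/admdef.lean` v22's `bipartiteNV_of_rootDichotomyDisc`)

CONDITIONAL on the displayed research texts (audit `proof.conditional`); `--supports stmt-BirchSwinnertonDyer-20727`.  For every non-split datum at `𝔭`:
fact (16) gives the Castella–Wan frame, a trace-coherent Heegner family `F`, the class `z ∈ 𝒮_+` which IS the `+` signed Heegner class of `F`, the
transfer inputs, the `+` system `B` with base class `z` and the definite dictionary; fact (15) turns the dictionary into clause (b); the root dichotomy
(`…AdmdefRootDichotomy.hasUnitLambda_of_rootDichotomy`) either sees `z_{0,1}` at an admissible Frobenius or yields (NP), whence `z_{0,1} = 0`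
(`…AdmdefRootZero`); with `d = dim_𝔽p Sel_p(E/K)[p] = 2k+1` ((Par) from (12)–(13)): `k = 0` — (irr_K) from `Surj`, the `μ = 0` frame of (7),
`…AdmdefHeegnerPrimitive.ne_smul_of_transferInputs_of_isUnit_coeff` ⟹ `z` p-primitive ⟹ (RV₁)H-pinned forbids `z_{0,1} = 0`; `k ≥ 1` — (Anch∃)_NP,≥3.
BSD / the crux / (RV₁)H / (Anch∃) are NOT proved here.
[cite: CastellaEtAl2025, Thm. 7.4, (7.1)–(7.2), Thm. 7.5, §7.4 (arXiv:2308.10474v2 pp. 30–33)] [cite: BurungaleCastellaSkinner2025, Prop. 4.2.2]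
[cite: CastellaWan2023, Prop. 4.4, Thm. 6.2] [cite: WZhang2014, §5 (5.1), Thm. 9.2, Lemma 7.3] [cite: Howard2006, Thm. 3.2.3 (c)] [cite: KimOta2023, Thm. 5.5]
-/

-- D-0017: single-problem summit, the namespace repeats the problem name by design.
set_option linter.dupNamespace false
set_option autoImplicit false

noncomputable section

open scoped Classical NumberField

open NumberField IsDedekindDomain Field
  Literature.NumberTheory.EllipticCurves Literature.NumberTheory.EllipticCurves.ModularForms
  Literature.NumberTheory.EllipticCurves.Rank1Residual Literature.NumberTheory.EllipticCurves.Castella2018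
  Literature.NumberTheory.EllipticCurves.CastellaWan2024 Literature.NumberTheory.GaloisRepresentations
  Literature.NumberTheory.EllipticCurves.YanZhu2026 Literature.NumberTheory.Automorphic
  Summit.BirchSwinnertonDyer.Rank1Residual.X11b Summit.BirchSwinnertonDyer.Rank1Residual.X11b.Halves
  Summit.BirchSwinnertonDyer.BirchSwinnertonDyer.Theorems
open Literature.NumberTheory.EllipticCurves.AcSigned Literature.NumberTheory.EllipticCurves.CastellaHsuKunduLeeLiu2025
  Literature.NumberTheory.EllipticCurves.BertoliniDarmon2005 Literature.NumberTheory.EllipticCurves.IwasawaDual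
open WeierstrassCurve (geomTorsion)

namespace Summit.BirchSwinnertonDyer.BirchSwinnertonDyer.Theorems.SignedBaseChangeAcDivAdmdefRootDichotomyDisc

open Summit.BirchSwinnertonDyer.BirchSwinnertonDyer.Theorems

/-- **[NV]♯ at a point (discriminant binders threaded) FROM facts (16), (15), (12), (13), (7) and the two research texts (RV₁)H-pinned and (Anch∃)_NP,≥3 [v22].**
See the module docstring for the route.  CONDITIONAL on the displayed texts. [cite: CastellaEtAl2025, Thm. 7.4, (7.2), Thm. 7.5, §7.4]
[cite: BurungaleCastellaSkinner2025, Prop. 4.2.2] [cite: CastellaWan2023, Thm. 6.2, Prop. 4.4] [cite: WZhang2014, §5 (5.1), Thm. 9.2] [cite: Howard2006, Thm. 3.2.3 (c)] -/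
theorem bipartiteNV_text_of_facts_of_heegnerPinned_of_anchor3
    (hCT : ∀ (K : Type) [Field K] [NumberField K], WeierstrassCurve.exists_casselsTate_pairing (K := K))
    (hDD : Literature.NumberTheory.EllipticCurves.dokchitser_selmerCorank_baseChange_mod_two_eq)
    (hP01 : thm74_eq72_exists_signedSystem_transferClass_dictionary)
    (hM1 : Literature.NumberTheory.EllipticCurves.DefiniteMultiplicityOne.kimOta2023_thm55_brandtEigenvector_modP_unique)
    (hmu : Literature.NumberTheory.EllipticCurves.BurungaleCastellaSkinner2025.prop422_exists_isBDPLFunction_mu_eq_zero)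
    (hH :
      ∀ {p : ℕ} [Fact p.Prime] (ι : PadicAlgCl p ≃+* ℂ) (W : WeierstrassCurve ℚ) [W.IsElliptic]
        [W.IsGloballyMinimal] (K : Type) [Field K] [NumberField K]
        (𝔭 𝔭bar : HeightOneSpectrum (𝓞 K)) (κ : ZpExtension K p) (γ : absoluteGaloisGroup K)
        [hγF : Fact (κ.IsTopGenerator γ)] {N : ℕ} [NeZero N] {f : CuspForm (CongruenceSubgroup.Gamma0 N) 2}
        (_ : IsNewformOf W f),
        (N : ℤ) = W.conductorNorm ℤ → 5 ≤ p → W.HasGoodReductionAtPrime p → W.frobeniusTrace p = 0 →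
        Surj W p →
        IsImaginaryQuadratic K → ((Ideal.span {(p : ℤ)}).primesOver (𝓞 K)).ncard = 2 →
          (h𝔭 : ((p : ℕ) : 𝓞 K) ∈ 𝔭.asIdeal) →
          (∀ (w : InfinitePlace K) (k : 𝓞 K), k ∈ 𝔭.asIdeal ↔ ‖ι.symm (w.embedding (k : K))‖ < 1) →
          ((p : ℕ) : 𝓞 K) ∈ 𝔭bar.asIdeal → (hne : 𝔭bar ≠ 𝔭) →
        (∀ ℓ : ℕ, ℓ.Prime → ℓ ∣ N → ((Ideal.span {(ℓ : ℤ)}).primesOver (𝓞 K)).ncard = 2) →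
        IsCoprime (N : ℤ) (NumberField.discr K) → ¬ p ∣ NumberField.classNumber K →
        Odd (NumberField.discr K) → NumberField.discr K ≠ -3 →
        ¬ Squarefree N →
        (∀ q : ℕ, q.Prime → q ∣ N →
          ∃ v : HeightOneSpectrum (𝓞 ℚ), ((q : ℕ) : 𝓞 ℚ) ∈ v.asIdeal ∧
            ∃ 𝔓 ∈ v.primesAbove, ∃ σ ∈ 𝔓.inertia (absoluteGaloisGroup ℚ),
              ∃ P : W.geomTorsion (p : ℤ), σ • P ≠ P) →
        ∀ [Module (ZMod p) (AdditiveKoly.Vp W K p)],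
          Module.finrank (ZMod p)
            (AddSubgroup.toZModSubmodule p (WeierstrassCurve.selmerGroup (W.baseChange K) ((p ^ 1 : ℕ) : ℤ))) = 1 →
          κ.IsAnticyclotomic →
          ∀ (h𝔭ns : AcSigned.IsNonsplitIn κ 𝔭) (γ𝔭 : absoluteGaloisGroup (𝔭.adicCompletion K))
            (hγ𝔭 : κ (resGalOfEmb (closureEmb (K := K) (𝔭.adicCompletion K)) γ𝔭) = κ γ)
            (ΩK : ℂ) (Ωp : (unrIntegers p)ˣ) (L : UnrSeries p), ΩK ≠ 0 →
            IsCWBDPLFunction ι 𝔭 κ γ f (NumberField.discr K) ΩK ((Ωp : unrIntegers p) : ℂ_[p]) L →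
            ∀ (jbar : AlgebraicClosure K →+* ℂ) (F : HeegnerFamily N W K κ jbar), F.IsTraceCoherentApZero →
            ∀ (z : AcSigned.selmerLambdaAdic (W.baseChange K) p κ γ (fun _ ↦ .sgn 1))
              (B : CastellaHsuKunduLeeLiu2025.SignedBipartiteSystem W K p κ),
              AcSigned.IsSignedHeegnerClass p κ γ F 1 z.1 →
              AcSigned.TransferInputs (W.baseChange K) p κ γ hγF.out 𝔭 h𝔭ns γ𝔭 hγ𝔭 𝔭bar (fun h ↦ hne h.symm) h𝔭 1 z L →
              CastellaHsuKunduLeeLiu2025.IsSignedBipartiteSystem W K p κ γ N 1 B → B.IsLimitBaseClass z.1 →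
              (∀ z'' : AcSigned.selmerLambdaAdic (W.baseChange K) p κ γ (fun _ ↦ .sgn 1), z ≠ p • z'') →
              z.1 0 1 ≠ 0)
    (hAnchE :
    ∀ {p : ℕ} [Fact p.Prime] (W : WeierstrassCurve ℚ) [W.IsElliptic] [W.IsGloballyMinimal]
      (K : Type) [Field K] [NumberField K] {N : ℕ} [NeZero N] {f : CuspForm (CongruenceSubgroup.Gamma0 N) 2}
      (_ : IsNewformOf W f),
      (N : ℤ) = W.conductorNorm ℤ → 5 ≤ p → W.HasGoodReductionAtPrime p → W.frobeniusTrace p = 0 →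
      Surj W p →
      IsImaginaryQuadratic K → ((Ideal.span {(p : ℤ)}).primesOver (𝓞 K)).ncard = 2 →
      (∀ ℓ : ℕ, ℓ.Prime → ℓ ∣ N → ((Ideal.span {(ℓ : ℤ)}).primesOver (𝓞 K)).ncard = 2) →
      IsCoprime (N : ℤ) (NumberField.discr K) → ¬ p ∣ NumberField.classNumber K →
      ¬ Squarefree N →
      (∀ q : ℕ, q.Prime → q ∣ N →
        ∃ v : HeightOneSpectrum (𝓞 ℚ), ((q : ℕ) : 𝓞 ℚ) ∈ v.asIdeal ∧
          ∃ 𝔓 ∈ v.primesAbove, ∃ σ ∈ 𝔓.inertia (absoluteGaloisGroup ℚ),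
            ∃ P : W.geomTorsion (p : ℤ), σ • P ≠ P) →
      -- (NP): some PINNED `+` tuple whose bottom class is invisible at every admissible Frobenius
      (∃ (ι : PadicAlgCl p ≃+* ℂ) (𝔭 𝔭bar : HeightOneSpectrum (𝓞 K)) (κ : ZpExtension K p) (γ : absoluteGaloisGroup K)
          (hγ : κ.IsTopGenerator γ) (h𝔭 : ((p : ℕ) : 𝓞 K) ∈ 𝔭.asIdeal) (hne : 𝔭bar ≠ 𝔭)
          (h𝔭ns : AcSigned.IsNonsplitIn κ 𝔭) (γ𝔭 : absoluteGaloisGroup (𝔭.adicCompletion K))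
          (hγ𝔭 : κ (resGalOfEmb (closureEmb (K := K) (𝔭.adicCompletion K)) γ𝔭) = κ γ)
          (ΩK : ℂ) (Ωp : (unrIntegers p)ˣ) (L : UnrSeries p)
          (z : AcSigned.selmerLambdaAdic (W.baseChange K) p κ γ (fun _ ↦ .sgn 1))
          (B : CastellaHsuKunduLeeLiu2025.SignedBipartiteSystem W K p κ),
          κ.IsAnticyclotomic ∧ (∀ (w : InfinitePlace K) (k : 𝓞 K), k ∈ 𝔭.asIdeal ↔ ‖ι.symm (w.embedding (k : K))‖ < 1) ∧
          ((p : ℕ) : 𝓞 K) ∈ 𝔭bar.asIdeal ∧ ΩK ≠ 0 ∧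
          IsCWBDPLFunction ι 𝔭 κ γ f (NumberField.discr K) ΩK ((Ωp : unrIntegers p) : ℂ_[p]) L ∧
          AcSigned.TransferInputs (W.baseChange K) p κ γ hγ 𝔭 h𝔭ns γ𝔭 hγ𝔭 𝔭bar (fun h ↦ hne h.symm) h𝔭 1 z L ∧
          CastellaHsuKunduLeeLiu2025.IsSignedBipartiteSystem W K p κ γ N 1 B ∧ B.IsLimitBaseClass z.1 ∧
          ∀ (q : ℕ), IsAdmissiblePrime N K (fun ℓ ↦ W.frobeniusTrace ℓ) p 1 q →
            ∀ (v : HeightOneSpectrum (𝓞 K)), ((q : ℕ) : 𝓞 K) ∈ v.asIdeal →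
            ∀ 𝔓 ∈ v.primesAbove, ∀ (φ : absoluteGaloisGroup K) (hφ : φ ∈ κ.kerSubgroup),
              φ ∈ 𝔓.decompositionSubgroup (absoluteGaloisGroup K) → IsArithFrobAt (𝓞 K) φ 𝔓 →
              resOfLe (geomTorsion (W.baseChange K) ((p : ℤ) ^ 1))
                ((Subgroup.zpowers_le.mpr hφ).trans (κ.kerSubgroup_le_layerSubgroup 0)) (z.1 0 1) = 0) →
      ∀ [Module (ZMod p) (AdditiveKoly.Vp W K p)],
        3 ≤ Module.finrank (ZMod p)
          (AddSubgroup.toZModSubmodule p (WeierstrassCurve.selmerGroup (W.baseChange K) ((p ^ 1 : ℕ) : ℤ))) →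
        ∃ s : Finset ℕ, IsZhangAdmissibleLevel N K (fun ℓ ↦ W.frobeniusTrace ℓ) p s ∧ Odd s.card ∧
          ∃ (S : Brandt.XiSetup N (∏ q ∈ s, q)) (ψ : K →ₐ[ℚ] S.D) (I : Submodule ℤ S.D) (φ : Brandt.ClassSet S.O → ZMod p),
            Brandt.IsGrossPoint S.O ψ I ∧
            (letI : Fintype (Brandt.ClassSet S.O) := Fintype.ofFinite _
             φ ∈ Brandt.eigenSpace (ZMod p) (N * ∏ q ∈ s, q) (Brandt.matrix S.O) (fun ℓ ↦ W.frobeniusTrace ℓ)) ∧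
            Brandt.toricPeriod S.O ψ I (fun i ↦ (Brandt.weight S.O i : ZMod p) * φ i) ≠ 0) :
    ∀ {p : ℕ} [Fact p.Prime] (ι : PadicAlgCl p ≃+* ℂ) (W : WeierstrassCurve ℚ) [W.IsElliptic]
      [W.IsGloballyMinimal] (K : Type) [Field K] [NumberField K]
      (𝔭 𝔭bar : HeightOneSpectrum (𝓞 K)) (κ : ZpExtension K p) (γ : absoluteGaloisGroup K)
      [hγF : Fact (κ.IsTopGenerator γ)] {N : ℕ} [NeZero N] {f : CuspForm (CongruenceSubgroup.Gamma0 N) 2}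
      (_ : IsNewformOf W f),
      (N : ℤ) = W.conductorNorm ℤ → 5 ≤ p → W.HasGoodReductionAtPrime p → W.frobeniusTrace p = 0 →
      Surj W p →
      IsImaginaryQuadratic K → ((Ideal.span {(p : ℤ)}).primesOver (𝓞 K)).ncard = 2 →
        (h𝔭 : ((p : ℕ) : 𝓞 K) ∈ 𝔭.asIdeal) →
        (∀ (w : InfinitePlace K) (k : 𝓞 K), k ∈ 𝔭.asIdeal ↔ ‖ι.symm (w.embedding (k : K))‖ < 1) →
        ((p : ℕ) : 𝓞 K) ∈ 𝔭bar.asIdeal → (hne : 𝔭bar ≠ 𝔭) →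
      (∀ ℓ : ℕ, ℓ.Prime → ℓ ∣ N → ((Ideal.span {(ℓ : ℤ)}).primesOver (𝓞 K)).ncard = 2) →
      IsCoprime (N : ℤ) (NumberField.discr K) → ¬ p ∣ NumberField.classNumber K →
      Odd (NumberField.discr K) → NumberField.discr K ≠ -3 →
      ¬ Squarefree N →
      (∀ q : ℕ, q.Prime → q ∣ N →
        ∃ v : HeightOneSpectrum (𝓞 ℚ), ((q : ℕ) : 𝓞 ℚ) ∈ v.asIdeal ∧
          ∃ 𝔓 ∈ v.primesAbove, ∃ σ ∈ 𝔓.inertia (absoluteGaloisGroup ℚ),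
            ∃ P : W.geomTorsion (p : ℤ), σ • P ≠ P) →
      κ.IsAnticyclotomic →
      ∀ (h𝔭ns : AcSigned.IsNonsplitIn κ 𝔭) (γ𝔭 : absoluteGaloisGroup (𝔭.adicCompletion K))
        (hγ𝔭 : κ (resGalOfEmb (closureEmb (K := K) (𝔭.adicCompletion K)) γ𝔭) = κ γ),
        ∃ (ΩK : ℂ) (Ωp : (unrIntegers p)ˣ) (L : UnrSeries p), ΩK ≠ 0 ∧
          IsCWBDPLFunction ι 𝔭 κ γ f (NumberField.discr K) ΩK ((Ωp : unrIntegers p) : ℂ_[p]) L ∧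
          ∃ (z : AcSigned.selmerLambdaAdic (W.baseChange K) p κ γ (fun _ ↦ .sgn 1))
            (B : CastellaHsuKunduLeeLiu2025.SignedBipartiteSystem W K p κ),
            AcSigned.TransferInputs (W.baseChange K) p κ γ hγF.out 𝔭 h𝔭ns γ𝔭 hγ𝔭 𝔭bar (fun h ↦ hne h.symm) h𝔭 1 z L ∧
            CastellaHsuKunduLeeLiu2025.IsSignedBipartiteSystem W K p κ γ N 1 B ∧ B.IsLimitBaseClass z.1 ∧ B.HasUnitLambda N := by
  intro p _ ι W _ _ K _ _ 𝔭 𝔭bar κ γ hγF N _ f hf hN hp hgood hap hsurj hK hsplit h𝔭 hι h𝔭bar hne hHeeg hcop hh hodd hne3 hnsq hram hac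
    h𝔭ns γ𝔭 hγ𝔭
  have hprime : p.Prime := Fact.out
  have hp2 : p ≠ 2 := by omega
  -- the bridge WITH its Heegner pinning: fact (16)
  have hS : AcSigned.Setting W K p κ 𝔭 𝔭bar :=
    { isElliptic := ‹_›
      p_ne_two := hp2
      goodSS := ⟨hgood, by rw [hap]; exact dvd_zero _⟩
      frobeniusTrace_eq_zero := hap
      isImaginaryQuadratic := hK
      mem := h𝔭
      mem' := h𝔭bar
      ne := hne
      anticyclotomic := hac
      not_dvd_classNumber := hh }
  have hN' : (W.conductorNorm ℤ : ℕ) = N := by exact_mod_cast hN.symm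
  have hHg : SatisfiesHeegnerHypothesis N K := fun ℓ hℓ hℓN ↦ hHeeg ℓ hℓ hℓN
  obtain ⟨ΩK, Ωp, L, hΩ, hBDP, jbar, F, hF, hsign⟩ :=
    hP01 N W K p κ 𝔭 𝔭bar hS ι hf hN' hHg hcop hp hsurj hι γ hγF.out h𝔭ns γ𝔭 hγ𝔭
  obtain ⟨z, B, hB, hbase, hzF, hT, hdict⟩ := hsign 1
  -- clause (b): unit weighted toric period at an odd admissible level ⟹ unit `λ⁺_1` there (dictionary + fact (15))
  have hbridge : ∀ s : Finset ℕ, IsZhangAdmissibleLevel N K (fun ℓ ↦ W.frobeniusTrace ℓ) p s → Odd s.card →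
      (∃ (S : Brandt.XiSetup N (∏ q ∈ s, q)) (ψ : K →ₐ[ℚ] S.D) (I : Submodule ℤ S.D) (φ : Brandt.ClassSet S.O → ZMod p),
          Brandt.IsGrossPoint S.O ψ I ∧
          (letI : Fintype (Brandt.ClassSet S.O) := Fintype.ofFinite _
           φ ∈ Brandt.eigenSpace (ZMod p) (N * ∏ q ∈ s, q) (Brandt.matrix S.O) (fun ℓ ↦ W.frobeniusTrace ℓ)) ∧
          Brandt.toricPeriod S.O ψ I (fun i ↦ (Brandt.weight S.O i : ZMod p) * φ i) ≠ 0) →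
      IsUnit (PowerSeries.constantCoeff (B.lam 1 (∏ q ∈ s, q))) := by
    rintro s hs hsodd ⟨S, ψ, I, φ, hG, hφ, hper⟩
    have hm : (∏ q ∈ s, q) ∈ CastellaHsuKunduLeeLiu2025.defProducts N K (fun ℓ ↦ W.frobeniusTrace ℓ) p 1 :=
      SignedBaseChangeAcDivAdmdefBipartiteNVLevelOne.prod_mem_defProducts_one hs hsodd
    obtain ⟨φg, hφg0, hφg, hiff⟩ := hdict (∏ q ∈ s, q) hm S
    have hφ0 : φ ≠ 0 := by
      rintro rfl
      exact hper (by rw [SignedBaseChangeAcDivOfStubsAdmdefV14.weight_mul_zero]; exact SignedBaseChangeAcDivOfStubsAdmdefV13.toricPeriod_zero S.O ψ I)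
    obtain ⟨c, hc⟩ := hM1 N W K p hN hp hgood hsurj hK hHeeg hram (∏ q ∈ s, q) hm S φg φ hφg hφ hφg0
    have hPg : Brandt.toricPeriod S.O ψ I (fun i ↦ (Brandt.weight S.O i : ZMod p) * φg i) ≠ 0 := by
      intro h0
      apply hper
      rw [hc, SignedBaseChangeAcDivOfStubsAdmdefV14.weight_mul_smul, SignedBaseChangeAcDivOfStubsAdmdefV13.toricPeriod_smul, h0, smul_zero]
    exact (hiff ψ I hG).mpr hPg
  refine ⟨ΩK, Ωp, L, hΩ, hBDP, z, B, hT, hB, hbase, ?_⟩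
  refine SignedBaseChangeAcDivAdmdefRootDichotomy.hasUnitLambda_of_rootDichotomy hB hbase
    (fun m ↦ ∃ (S : Brandt.XiSetup N m) (ψ : K →ₐ[ℚ] S.D) (I : Submodule ℤ S.D) (φ : Brandt.ClassSet S.O → ZMod p),
      Brandt.IsGrossPoint S.O ψ I ∧
      (letI : Fintype (Brandt.ClassSet S.O) := Fintype.ofFinite _
       φ ∈ Brandt.eigenSpace (ZMod p) (N * m) (Brandt.matrix S.O) (fun ℓ ↦ W.frobeniusTrace ℓ)) ∧
      Brandt.toricPeriod S.O ψ I (fun i ↦ (Brandt.weight S.O i : ZMod p) * φ i) ≠ 0)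
    hbridge fun hinv ↦ ?_
  -- NON-primitive root: the bottom class vanishes (Čebotarev half)
  have hz0 : z.1 0 1 = 0 :=
    SignedBaseChangeAcDivAdmdefRootZero.eq_zero_of_forall_admissibleFrob_resOfLe_eq_zero hN hp hsurj hK hHeeg hsplit κ hac (z.1 0 1) hinv
  obtain ⟨c, hc1⟩ := AdditiveKoly.exists_algEquiv_ne_one_of_isImaginaryQuadratic K hK
  letI : Module (ZMod p) (AdditiveKoly.Vp W K p) :=
    AddCommGroup.zmodModule (SignedBaseChangeAcDivOfStubsAdmdefV8.p_nsmul_vp_eq_zero' W K)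
  have hpar := SignedBaseChangeAcDivAdmdefOddSelmerDim.oddSelmerDim_of_casselsTate_of_dokchitser hCT hDD W K hN hp hsurj hK hHeeg c hc1
  have hdim := AdditiveKoly.finrank_selmer_eq_finrank_selQP_add W K p hp2 hK c
    (SignedBaseChangeAcDivAdmdefOddSelmerDim.algEquiv_mul_self_eq_one_of_ne_one hK.1 hc1)
  obtain ⟨k, hk⟩ := hpar
  rcases Nat.eq_zero_or_pos k with hk0 | hk0
  · -- the core root `d = 1`: `μ(L_p^BDP) = 0` (fact (7)) makes the Heegner class p-PRIMITIVE, and (RV₁)H-pinned forbids `z_{0,1} = 0`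
    subst hk0
    have hirr : (W.baseChange K).HasIrreducibleModPGaloisRep p :=
      Summit.BirchSwinnertonDyer.Rank1Residual.irrK_of_surj W p hsurj K hK.1
    obtain ⟨ΩK', Ωp', LC, hΩK', hLC, hμ⟩ :=
      hmu ι W K 𝔭 κ γ hf (by omega) hgood hK hHg hsplit hodd hne3 hirr h𝔭 hι hac hγF.out
    have hpN : ¬ p ∣ N := by
      rw [← hN']
      exact not_dvd_conductorNorm_of_hasGoodReductionAtPrime W hgood
    have hpD : ¬ (p : ℤ) ∣ NumberField.discr K :=
      not_dvd_discr_of_ncard_primesOver hprime (by rw [hK.1]; exact hsplit)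
    have hprim : ∀ z'' : AcSigned.selmerLambdaAdic (W.baseChange K) p κ γ (fun _ ↦ .sgn 1), z ≠ p • z'' :=
      SignedBaseChangeAcDivAdmdefHeegnerPrimitive.ne_smul_of_transferInputs_of_isUnit_coeff hp2 hK hac hpN hpD hΩ hΩK' hBDP hLC hμ hT
    exact absurd hz0 (hH ι W K 𝔭 𝔭bar κ γ hf hN hp hgood hap hsurj hK hsplit h𝔭 hι h𝔭bar hne hHeeg hcop hh hodd hne3
      hnsq hram (hdim.trans (hk.trans (by omega))) hac h𝔭ns γ𝔭 hγ𝔭 ΩK Ωp L hΩ hBDP jbar F hF z B hzF hT hB hbase hprim)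
  · -- off the core root: `d ≥ 3`, the anchor fires on the (NP) witness
    have h3 := le_of_le_of_eq (show 3 ≤ 2 * k + 1 by omega) (hdim.trans hk).symm
    exact hAnchE W K hf hN hp hgood hap hsurj hK hsplit hHeeg hcop hh hnsq hram
      ⟨ι, 𝔭, 𝔭bar, κ, γ, hγF.out, h𝔭, hne, h𝔭ns, γ𝔭, hγ𝔭, ΩK, Ωp, L, z, B, hac, hι, h𝔭bar, hΩ, hBDP, hT, hB, hbase, hinv⟩ h3

end Summit.BirchSwinnertonDyer.BirchSwinnertonDyer.Theorems.SignedBaseChangeAcDivAdmdefRootDichotomyDisc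

end
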